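import Literature.Geometry.Symplectic.OrigamiUnfoldingProofs
import Literature.Geometry.Manifold.HypersurfaceLocalSides
import HarnessLib

/-!
# Unfolding of an origami 4-manifold — step (S0) completed: the sides `M⁺`, `M⁻` are connected

Companion of `OrigamiUnfoldingProofs.lean` (step (S0) of the unfolding of Cannas da
Silva–Guillemin–Pires 2010, Prop. 2.8: for an orientation `o` the complement of the fold of an
origami form is the disjoint union of the non-empty open sides `M⁺ = posSide o s`,
`M⁻ = posSide (-o) s`).  That file leaves open "connectedness of `M^±` for connected `M` and `Z`
(needs a collar of `Z`)".  We prove it here WITHOUT a collar, from the local two-sidedness of the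
smoothly embedded folding hypersurface (`Literature.Geometry.Manifold.exists_local_sides`) and that
file's `IsFoldedForm.mem_closure_posSide` (every fold point is adherent to `M⁺(o)` for EVERY
orientation `o`, hence to both sides — the transversality clause `ω ∧ ω ⋔ 0`):

* `isPreconnected_of_two_sided` — point-set core: `X` connected, `V₊, V₋` disjoint open with
  `V₊ ∪ V₋ = Zᶜ`, `Z` preconnected, contained in the closure of BOTH, and locally two-sided
  (every point has a neighbourhood `O` with `O ∖ Z` inside two preconnected subsets of `Zᶜ`);
  then `V₊` is preconnected.  (If `V₊ = A ⊔ B` with `A, B` open non-empty, the closed sets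
  `Z ∩ cl A`, `Z ∩ cl B` cover `Z` and are disjoint — at a common point the two local sides
  would have to lie in `A` and in `B`, leaving none for `V₋` — so one of them, say `Z ∩ cl B`, is
  empty, and then `B` is clopen, non-empty and proper in `X`.)
* `IsFoldedForm.isConnected_posSide` — **`M⁺(o)` is connected** when `M` and the fold are; and
  the package `IsOrigamiForm.exists_sides_connected`: conjunct one of the named fact
  `exists_symplecticCutPieces_of_isOrigamiForm` (`OrigamiUnfolding.lean`) with, in addition, the
  sides CONNECTED and `frontier (V i) = fold s` (`IsFoldedForm.frontier_posSide`) — what remark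
  (b) of that fact's docstring and the `ConnectedSpace (N i)` clause of its conclusion rest on
  (`M^±` is dense in the cut piece `M₀^±`).

## References

* [CannasdasilvaGuilleminPires2010] A. Cannas da Silva, V. Guillemin, A. R. Pires, *Symplectic
  Origami*, IMRN 2011 = arXiv:0909.4065, §2.1, Prop. 2.8.
* J. M. Lee, *Introduction to Smooth Manifolds*, 2nd ed. (2013), Thm. 5.8 (local sides of an
  embedded hypersurface, via `HypersurfaceLocalSides.lean`).
-/

noncomputable section

open scoped Manifold ContDiff Topology
open Set Function Filter
open Literature.Geometry.Kaehler
open Literature.Topology.FourManifolds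

namespace Literature.Geometry.Symplectic

/-! ### Point-set core -/

/-- A preconnected subset of the union of two disjoint open sets which meets the first lies in
the first. [folklore] -/
theorem isPreconnected_subset_left_of_mem {X : Type*} [TopologicalSpace X] {H A B : Set X}
    (hH : IsPreconnected H) (hA : IsOpen A) (hB : IsOpen B) (hAB : Disjoint A B)
    (hHAB : H ⊆ A ∪ B) {a : X} (haH : a ∈ H) (haA : a ∈ A) : H ⊆ A := by
  rcases hH.subset_or_subset hA hB hAB hHAB with h | h
  · exact h
  · exact absurd (h haH) (hAB.notMem_of_mem_left haA)

/-- **A locally two-sided preconnected splitting set adherent to both pieces has preconnected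
pieces.**  Let `X` be connected, `V₊, V₋ ⊆ X` disjoint open sets with `V₊ ∪ V₋ = Zᶜ`, where `Z`
is preconnected, lies in the closure of `V₊` AND of `V₋`, and is locally two-sided: every point
of `Z` has an open neighbourhood `O` with `O ⊆ Z ∪ H₁ ∪ H₂` for two preconnected subsets
`H₁, H₂` of `Zᶜ`.  Then `V₊` is preconnected. [folklore] -/
theorem isPreconnected_of_two_sided {X : Type*} [TopologicalSpace X] [ConnectedSpace X]
    {Vp Vm Z : Set X} (hVp : IsOpen Vp) (hVm : IsOpen Vm) (hdisj : Disjoint Vp Vm)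
    (hunion : Vp ∪ Vm = Zᶜ) (hZ : IsPreconnected Z) (hclp : Z ⊆ closure Vp)
    (hclm : Z ⊆ closure Vm)
    (hloc : ∀ x ∈ Z, ∃ O H₁ H₂ : Set X, IsOpen O ∧ x ∈ O ∧ IsPreconnected H₁ ∧
      IsPreconnected H₂ ∧ H₁ ⊆ Zᶜ ∧ H₂ ⊆ Zᶜ ∧ O ⊆ Z ∪ (H₁ ∪ H₂)) :
    IsPreconnected Vp := by
  rw [isPreconnected_iff_subset_of_disjoint]
  intro u v hu hv hsub hempty
  by_contra hcon
  push Not at hcon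
  obtain ⟨hnu, hnv⟩ := hcon
  -- the two non-empty open pieces `A = V₊ ∩ u`, `B = V₊ ∩ v`
  set A := Vp ∩ u with hA
  set B := Vp ∩ v with hB
  have hAo : IsOpen A := hVp.inter hu
  have hBo : IsOpen B := hVp.inter hv
  have hABd : Disjoint A B := by
    rw [Set.disjoint_iff_inter_eq_empty]
    apply Set.eq_empty_of_subset_empty
    rw [← hempty]
    rintro x ⟨⟨hx, hxu⟩, -, hxv⟩
    exact ⟨hx, hxu, hxv⟩
  have hAB : A ∪ B = Vp := by
    apply Subset.antisymm
    · rintro x (hx | hx)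
      · exact hx.1
      · exact hx.1
    · intro x hx
      rcases hsub hx with h | h
      · exact Or.inl ⟨hx, h⟩
      · exact Or.inr ⟨hx, h⟩
  have hAne : A.Nonempty := by
    obtain ⟨a, haV, hav⟩ := not_subset.1 hnv
    exact ⟨a, haV, (hsub haV).resolve_right hav⟩
  have hBne : B.Nonempty := by
    obtain ⟨b, hbV, hbu⟩ := not_subset.1 hnu
    exact ⟨b, hbV, (hsub hbV).resolve_left hbu⟩
  -- `Zᶜ = A ∪ (B ∪ V₋) = B ∪ (A ∪ V₋)`, disjoint open decompositions
  have hAVm : Disjoint A Vm := hdisj.mono_left inter_subset_left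
  have hBVm : Disjoint B Vm := hdisj.mono_left inter_subset_left
  have hZc : Zᶜ = A ∪ (B ∪ Vm) := by rw [← union_assoc, hAB, hunion]
  have hZc' : Zᶜ = B ∪ (A ∪ Vm) := by rw [hZc]; ac_rfl
  -- no point of `Z` is adherent to both `A` and `B`
  have hnot : ∀ z ∈ Z, z ∈ closure A → z ∈ closure B → False := by
    intro z hz hzA hzB
    obtain ⟨O, H₁, H₂, hOo, hzO, hH₁, hH₂, hH₁Z, hH₂Z, hcov⟩ := hloc z hz
    -- a local side meeting `A` lies in `A`, etc.
    have sideA : ∀ {H : Set X}, IsPreconnected H → H ⊆ Zᶜ → ∀ a ∈ H, a ∈ A → H ⊆ A :=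
      fun hH hHZ a haH haA =>
        isPreconnected_subset_left_of_mem hH hAo (hBo.union hVm) (hABd.union_right hAVm)
          (hZc ▸ hHZ) haH haA
    have sideB : ∀ {H : Set X}, IsPreconnected H → H ⊆ Zᶜ → ∀ b ∈ H, b ∈ B → H ⊆ B :=
      fun hH hHZ b hbH hbB =>
        isPreconnected_subset_left_of_mem hH hBo (hAo.union hVm) (hABd.symm.union_right hBVm)
          (hZc' ▸ hHZ) hbH hbB
    -- points of `A`, `B`, `V₋` inside `O`
    obtain ⟨a, haO, haA⟩ := mem_closure_iff.1 hzA O hOo hzO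
    obtain ⟨b, hbO, hbB⟩ := mem_closure_iff.1 hzB O hOo hzO
    obtain ⟨c, hcO, hcV⟩ := mem_closure_iff.1 (hclm hz) O hOo hzO
    have haZ : a ∉ Z := fun h => by
      have : a ∈ Zᶜ := hZc ▸ Or.inl haA
      exact this h
    have hbZ : b ∉ Z := fun h => by
      have : b ∈ Zᶜ := hZc' ▸ Or.inl hbB
      exact this h
    have hcZ : c ∉ Z := fun h => by
      have : c ∈ Zᶜ := hunion ▸ Or.inr hcV
      exact this h
    -- the two local sides lie in `A ∪ B`
    have hHAB : H₁ ∪ H₂ ⊆ A ∪ B := by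
      rcases (hcov haO).resolve_left haZ with ha | ha <;>
        rcases (hcov hbO).resolve_left hbZ with hb | hb
      · exact absurd (sideB hH₁ hH₁Z b hb hbB ha) (hABd.notMem_of_mem_left haA)
      · exact union_subset ((sideA hH₁ hH₁Z a ha haA).trans subset_union_left)
          ((sideB hH₂ hH₂Z b hb hbB).trans subset_union_right)
      · exact union_subset ((sideB hH₁ hH₁Z b hb hbB).trans subset_union_right)
          ((sideA hH₂ hH₂Z a ha haA).trans subset_union_left)
      · exact absurd (sideB hH₂ hH₂Z b hb hbB ha) (hABd.notMem_of_mem_left haA)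
    -- but the point `c ∈ V₋ ∩ O` lies in a local side, hence in `A ∪ B ⊆ V₊`
    have hcAB : c ∈ A ∪ B := hHAB ((hcov hcO).resolve_left hcZ)
    rw [hAB] at hcAB
    exact hdisj.notMem_of_mem_left hcAB hcV
  -- `Z ⊆ closure A ∪ closure B`, so by preconnectedness `Z` misses one of the two closures
  have hZcov : Z ⊆ closure A ∪ closure B := by
    rw [← closure_union, hAB]
    exact hclp
  have hZempty : Z ∩ (closure A ∩ closure B) = ∅ :=
    Set.eq_empty_iff_forall_notMem.2 fun z ⟨hz, hzA, hzB⟩ => hnot z hz hzA hzB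
  -- a piece whose closure misses `Z` is clopen, hence everything: contradiction
  have key : ∀ {C D : Set X}, IsOpen C → IsOpen D → C.Nonempty → D.Nonempty → Disjoint C D →
      C ∪ D = Vp → Z ∩ closure D = ∅ → False := by
    intro C D hCo hDo hCne hDne hCD hCDV hZD
    have hDcl : IsClosed D := by
      refine closure_subset_iff_isClosed.1 fun y hy => ?_
      have hyZ : y ∉ Z := fun h => (Set.eq_empty_iff_forall_notMem.1 hZD) y ⟨h, hy⟩
      have hyC : y ∉ C := (hCD.symm.closure_left hCo).notMem_of_mem_left hy
      have hyVm : y ∉ Vm :=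
        ((hdisj.mono_left (hCDV ▸ subset_union_right)).closure_left hVm).notMem_of_mem_left hy
      have hy' : y ∈ Zᶜ := hyZ
      rw [← hunion, ← hCDV] at hy'
      rcases hy' with (h | h) | h
      · exact absurd h hyC
      · exact h
      · exact absurd h hyVm
    have hDu : D = univ := IsClopen.eq_univ ⟨hDcl, hDo⟩ hDne
    obtain ⟨c, hc⟩ := hCne
    exact hCD.notMem_of_mem_left hc (hDu ▸ mem_univ c)
  rcases (isPreconnected_iff_subset_of_disjoint_closed.1 hZ) (closure A) (closure B)
    isClosed_closure isClosed_closure hZcov hZempty with h | h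
  · refine key hAo hBo hAne hBne hABd hAB (Set.eq_empty_iff_forall_notMem.2 ?_)
    rintro z ⟨hz, hzB⟩
    exact hnot z hz (h hz) hzB
  · refine key hBo hAo hBne hAne hABd.symm (by rw [union_comm, hAB])
      (Set.eq_empty_iff_forall_notMem.2 ?_)
    rintro z ⟨hz, hzA⟩
    exact hnot z hz hzA (h hz)

/-! ### The sides are connected -/

variable {M : Type*} [TopologicalSpace M] [ChartedSpace (EuclideanSpace ℝ (Fin 4)) M]
  [IsManifold (𝓡 4) ∞ M]
  {N : Type} [TopologicalSpace N] [ChartedSpace (EuclideanSpace ℝ (Fin 3)) N] {j : N → M}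

omit [IsManifold (𝓡 4) ∞ M] in
/-- The fold of a folded form is locally two-sided (it is a smoothly embedded hypersurface;
`Literature.Geometry.Manifold.exists_local_sides`). [cite: LeeSmoothManifolds2013, Thm. 5.8] -/
theorem IsFoldedForm.fold_locally_two_sided {s : MForm (𝓡 4) M ℝ 2} (hs : IsFoldedForm s N j) :
    ∀ x ∈ fold s, ∃ O H₁ H₂ : Set M, IsOpen O ∧ x ∈ O ∧ IsPreconnected H₁ ∧
      IsPreconnected H₂ ∧ H₁ ⊆ (fold s)ᶜ ∧ H₂ ⊆ (fold s)ᶜ ∧ O ⊆ fold s ∪ (H₁ ∪ H₂) := by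
  intro x hx
  rw [← hs.range_eq] at hx ⊢
  obtain ⟨n, rfl⟩ := hx
  obtain ⟨O, H₁, H₂, hO, hxO, hH₁, hH₂, hH₁Z, hH₂Z, hcov, -, -⟩ :=
    Literature.Geometry.Manifold.exists_local_sides (n := 3) hs.embedding n
  exact ⟨O, H₁, H₂, hO, hxO, hH₁, hH₂, hH₁Z, hH₂Z, hcov⟩

/-- **`M⁺(o)` is connected** for a folded form with connected fold on a connected 4-manifold
(for every orientation `o`; `M⁻ = M⁺(-o)`).
[cite: CannasdasilvaGuilleminPires2010, §2.1 and Prop. 2.8] -/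
theorem IsFoldedForm.isConnected_posSide [ConnectedSpace M] {s : MForm (𝓡 4) M ℝ 2}
    (hs : IsFoldedForm s N j) (hconn : IsConnected (fold s)) (o : SmoothOrientation (𝓡 4) M) :
    IsConnected (posSide o s) := by
  obtain ⟨z, hz⟩ := hconn.nonempty
  refine ⟨hs.posSide_nonempty o hz, ?_⟩
  exact isPreconnected_of_two_sided (isOpen_posSide o hs.smooth) (isOpen_posSide (-o) hs.smooth)
    (disjoint_posSide_posSide_neg o s) (posSide_union_posSide_neg o s) hconn.isPreconnected
    (fun _ hx => hs.mem_closure_posSide o hx) (fun _ hx => hs.mem_closure_posSide (-o) hx)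
    hs.fold_locally_two_sided

/-- **Step (S0) of the unfolding with connected sides.** On a connected orientable 4-manifold
carrying an origami form with connected fold `Z`, the complement of the fold is the disjoint
union of two NON-EMPTY CONNECTED open sides `V 0 = M⁺`, `V 1 = M⁻`, each with frontier exactly
`Z` — conjunct one of `exists_symplecticCutPieces_of_isOrigamiForm` (Cannas da
Silva–Guillemin–Pires 2010, §2.1, Prop. 2.8), strengthened by the connectedness on which the
`ConnectedSpace (N i)` clause of that fact rests (`M^±` is dense in the cut piece `M₀^±`).
[cite: CannasdasilvaGuilleminPires2010, §2.1 and Prop. 2.8] -/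
theorem IsOrigamiForm.exists_sides_connected [ConnectedSpace M] {s : MForm (𝓡 4) M ℝ 2}
    (hs : IsOrigamiForm s) (hM : IsOrientable (𝓡 4) M) (hZ : IsConnected (fold s)) :
    ∃ V : Fin 2 → TopologicalSpace.Opens M,
      Disjoint (V 0) (V 1) ∧ (∀ i, (V i : Set M).Nonempty) ∧ (∀ i, IsConnected (V i : Set M)) ∧
        ((V 0 : Set M) ∪ (V 1 : Set M))ᶜ = fold s ∧ ∀ i, frontier (V i : Set M) = fold s := by
  obtain ⟨o⟩ := hM
  obtain ⟨N, _, _, _, _, j, hf⟩ := hs.exists_isFoldedForm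
  have h0 : IsConnected (posSide o s) := hf.isConnected_posSide hZ o
  have h1 : IsConnected (posSide (-o) s) := hf.isConnected_posSide hZ (-o)
  have hfr1 : frontier (posSide (-o) s) = fold s := hf.frontier_posSide (-o)
  refine ⟨![⟨posSide o s, isOpen_posSide o hf.smooth⟩,
    ⟨posSide (-o) s, isOpen_posSide (-o) hf.smooth⟩], ?_, ?_, ?_, ?_, ?_⟩
  · rw [← TopologicalSpace.Opens.coe_disjoint]
    exact disjoint_posSide_posSide_neg o s
  · intro i
    fin_cases i
    · exact h0.nonempty
    · exact h1.nonempty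
  · intro i
    fin_cases i
    · exact h0
    · exact h1
  · change (posSide o s ∪ posSide (-o) s)ᶜ = fold s
    rw [posSide_union_posSide_neg, compl_compl]
  · intro i
    fin_cases i
    · exact hf.frontier_posSide o
    · exact hfr1

end Literature.Geometry.Symplectic

end
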